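import Literature.Topology.FourManifolds.SurgeryCylinderFrames
import Literature.Topology.FourManifolds.SurgeredStableFrameGlue
import Literature.Topology.FourManifolds.SurgerySwapMatrix
import HarnessLib

/-!
# Cylinder frames of a spherical modification, II: frame fields along maps and the tube frame

Topic `Literature/Topology/FourManifolds` (fact seat of
`Literature.Topology.FourManifolds.HomotopySphere.boundsContractible_of_nullCobordism_isStablyParallelizable_four`;
towards Kervaire–Milnor's Lemma 5.4 / 6.2).  Continuation of `SurgeryCylinderFrames.lean`:

* `IsFrameFieldAlong I G F R` — **stable frame fields along a map into a manifold with ANY model**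
  on `ℝᵐ` (boundary allowed): the tree's `IsStableFrameFieldOn` (`𝓡 m` only) verbatim for a
  model with corners `I : ModelWithCorners ℝ ℝᵐ H`; chart readings `chartReadI`,
  `IsFrameFieldAlong.continuousOn_chartRead`, and **continuity of the comparison matrix of two
  frame fields along the same map** `IsFrameFieldAlong.continuousOn_compMat` (read in a chart,
  `compMat` being invariant under linear automorphisms, `StableFrames.compMat_map`).
* `continuousOn_totalSpaceMk_prodSelf` — sections of the tangent bundle of a product `E × F` of
  two model vector spaces are continuous as soon as their vector parts are (the atlas has one
  chart).
* `FramedSphereFamily.tubeCyl ν i h q` — **the tube cylinder frame** of the `i`-th framed sphere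
  at `q = (u, w)`: the `SurgerySwapMatrix` frame `cylT (u, w) h (dφ̂_{(u,w)})` read through the cone
  (`coneDeriv`); it is a frame (`linearIndependent_tubeCyl`, from `eq_zero_of_coneDeriv_eq_zero`)
  and a stable frame field along `φᵢ` (`isFrameFieldAlong_tubeCyl`: push-forward of the constant
  fields of `T(ℝᵏ⁺¹ × ℝᵐ)` along the cone).

Everything is proved; the `def`s are explicit; no named facts.

## References

* M. Kervaire, J. Milnor, *Groups of homotopy spheres I*, Ann. of Math. (2) 77 (1963), §6
  pp. 520–522. doi:10.2307/1970128 [KervaireMilnorAnnals1963]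
* A. Kosinski, *Differential Manifolds* (1993), Ch. X §2, Lemma (2.1), p. 200. [Kosinski1993]
* N. Steenrod, *The Topology of Fibre Bundles* (1951), §7–8. [Steenrod1951]
-/

noncomputable section

open scoped Manifold ContDiff Topology RealInnerProductSpace
open Set Function Bundle Metric Module

namespace Literature.Topology.FourManifolds

open StableFrames StableFrames.SurgerySwap

/-! ### Sections of the tangent bundle of a product of model vector spaces -/

section ProdSelf

variable {E F : Type*} [NormedAddCommGroup E] [NormedSpace ℝ E] [NormedAddCommGroup F]
  [NormedSpace ℝ F] {Y : Type*} [TopologicalSpace Y]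

/-- **Vector fields along maps into a product `E × F` of model vector spaces** are continuous into
the tangent bundle (product model `𝓘(E) × 𝓘(F)`) as soon as base map and vector part are: the
product charted space has the single chart `id × id`, so the tangent-bundle coordinate changes
are identities (`VectorBundleCore.coordChange_self`). [folklore] -/
theorem continuousOn_totalSpaceMk_prodSelf {b v : Y → E × F} {t : Set Y} (hb : ContinuousOn b t)
    (hv : ContinuousOn v t) :
    ContinuousOn (fun y => (TotalSpace.mk' (E × F) (b y) (v y) :
      TangentBundle ((𝓘(ℝ, E)).prod 𝓘(ℝ, F)) (E × F))) t := by
  intro y₀ hy₀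
  rw [FiberBundle.continuousWithinAt_totalSpace]
  refine ⟨hb y₀ hy₀, ?_⟩
  have key : ∀ y, (trivializationAt (E × F) (TangentSpace ((𝓘(ℝ, E)).prod 𝓘(ℝ, F))) (b y₀)
      (TotalSpace.mk' (E × F) (b y) (v y) : TangentBundle ((𝓘(ℝ, E)).prod 𝓘(ℝ, F)) (E × F))).2 = v y := by
    intro y
    rw [TangentBundle.trivializationAt_apply]
    change (tangentBundleCore ((𝓘(ℝ, E)).prod 𝓘(ℝ, F)) (E × F)).coordChange
      (achart (ModelProd E F) (b y)) (achart (ModelProd E F) (b y₀)) (b y) (v y) = v y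
    exact (tangentBundleCore ((𝓘(ℝ, E)).prod 𝓘(ℝ, F)) (E × F)).coordChange_self
      (achart (ModelProd E F) (b y)) (b y) (by simp) (v y)
  exact (hv y₀ hy₀).congr (fun y _ => key y) (key y₀)

end ProdSelf

/-! ### Stable frame fields along maps into a manifold with boundary -/

section FrameField

variable {m : ℕ} {H : Type*} [TopologicalSpace H] {I : ModelWithCorners ℝ (EuclideanSpace ℝ (Fin m)) H}
  {M : Type*} [TopologicalSpace M] [ChartedSpace H M] [IsManifold I 1 M] {Y : Type*} [TopologicalSpace Y]

variable (I) in
/-- **A stable frame field along `G` over the region `R`**, for a manifold `M` modelled by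
`I : ModelWithCorners ℝ ℝᵐ H` (boundary or corners allowed): `m + 1` vectors `F q i` of
`T_{G q} M × ℝ` whose tangent components are continuous into `TM` on `R`, whose real components
are continuous on `R`, and which are linearly independent on `R` (the tree's
`IsStableFrameFieldOn`, written for a general model). [cite: Steenrod1951, §7–8] -/
def IsFrameFieldAlong (G : Y → M) (F : Y → Fr m) (R : Set Y) : Prop :=
  (∀ i, ContinuousOn (fun q => (TotalSpace.mk' (EuclideanSpace ℝ (Fin m)) (G q) (F q i).1 :
      TangentBundle I M)) R) ∧
    (∀ i, ContinuousOn (fun q => (F q i).2) R) ∧ ∀ q ∈ R, LinearIndependent ℝ (F q)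

namespace IsFrameFieldAlong

variable {G : Y → M} {F F₁ F₂ : Y → Fr m} {R P : Set Y}

/-- Restriction to a smaller region. [folklore] -/
theorem mono (h : IsFrameFieldAlong I G F R) (hP : P ⊆ R) : IsFrameFieldAlong I G F P :=
  ⟨fun i => (h.1 i).mono hP, fun i => (h.2.1 i).mono hP, fun q hq => h.2.2 q (hP hq)⟩

/-- The map along which a frame field is defined is continuous on the region. [folklore] -/
theorem continuousOn_map (h : IsFrameFieldAlong I G F R) : ContinuousOn G R :=
  (FiberBundle.continuous_proj (EuclideanSpace ℝ (Fin m)) (TangentSpace I)).comp_continuousOn (h.1 0)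

/-- Precomposition with a map continuous on `P` with `ρ(P) ⊆ R`. [folklore] -/
theorem comp {Z : Type*} [TopologicalSpace Z] (h : IsFrameFieldAlong I G F R) {ρ : Z → Y} {P : Set Z}
    (hρ : ContinuousOn ρ P) (hPR : MapsTo ρ P R) : IsFrameFieldAlong I (G ∘ ρ) (F ∘ ρ) P :=
  ⟨fun i => (h.1 i).comp hρ hPR, fun i => (h.2.1 i).comp hρ hPR, fun _ hq => h.2.2 _ (hPR hq)⟩

end IsFrameFieldAlong

/-- **Reading a frame in a chart**: apply the differential of the chart at `z` to the tangent
components. [folklore] -/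
def chartReadI (I : ModelWithCorners ℝ (EuclideanSpace ℝ (Fin m)) H) (z x : M) (F : Fr m) : Fr m :=
  fun i => (mfderiv I I (chartAt H z) x (F i).1, (F i).2)

/-- The chart reading as a linear automorphism of `ℝᵐ × ℝ` at points of the chart domain.
[folklore] -/
def chartReadIEquiv (z : M) {x : M} (hx : x ∈ (chartAt H z).source) :
    ((EuclideanSpace ℝ (Fin m)) × ℝ) ≃ₗ[ℝ] ((EuclideanSpace ℝ (Fin m)) × ℝ) :=
  ((mdifferentiable_chart (I := I) z : (chartAt H z).MDifferentiable I I).mfderiv hx).toLinearEquiv.prodCongr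
    (LinearEquiv.refl ℝ ℝ)

/-- The chart reading is composition with `chartReadIEquiv`. [folklore] -/
theorem chartReadI_eq (z : M) {x : M} (hx : x ∈ (chartAt H z).source) (F : Fr m) :
    chartReadI I z x F = (chartReadIEquiv (I := I) z hx) ∘ F := by
  funext i
  simp only [chartReadI, chartReadIEquiv, Function.comp_apply]
  rfl

/-- Chart readings of frames are frames. [folklore] -/
theorem linearIndependent_chartReadI (z : M) {x : M} (hx : x ∈ (chartAt H z).source) {F : Fr m}
    (hF : LinearIndependent ℝ F) : LinearIndependent ℝ (chartReadI I z x F) := by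
  rw [chartReadI_eq (I := I) z hx]
  exact hF.map' (chartReadIEquiv (I := I) z hx).toLinearMap (chartReadIEquiv (I := I) z hx).ker

/-- Comparison matrices can be computed in a chart. [folklore] -/
theorem compMat_chartReadI (z : M) {x : M} (hx : x ∈ (chartAt H z).source) {A B : Fr m}
    (hB : LinearIndependent ℝ B) :
    compMat (chartReadI I z x A) (chartReadI I z x B) = compMat A B := by
  rw [chartReadI_eq (I := I) z hx, chartReadI_eq (I := I) z hx]
  exact compMat_map (chartReadIEquiv (I := I) z hx) hB

/-- The vector component `TH → ℝᵐ` of the tangent bundle of the model space is continuous.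
[folklore] -/
theorem continuous_snd_tangentBundle_modelSpace :
    Continuous (fun p : TangentBundle I H => p.2) :=
  continuous_snd.comp (tangentBundleModelSpaceHomeomorph I).continuous

/-- **A frame field read in a chart has continuous coordinates** on the part of the region mapped
into the chart domain. [cite: Steenrod1951, §7–8] -/
theorem IsFrameFieldAlong.continuousOn_chartRead {G : Y → M} {F : Y → Fr m} {R : Set Y}
    (h : IsFrameFieldAlong I G F R) (z : M) :
    ContinuousOn (fun q => chartReadI I z (G q) (F q)) (R ∩ G ⁻¹' (chartAt H z).source) := by
  refine continuousOn_pi.mpr fun i => ?_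
  refine ContinuousOn.prodMk ?_ ((h.2.1 i).mono inter_subset_left)
  have h1 : ContinuousOn (fun q => (TotalSpace.mk' (EuclideanSpace ℝ (Fin m)) (G q) (F q i).1 :
      TangentBundle I M)) (R ∩ G ⁻¹' (chartAt H z).source) := (h.1 i).mono inter_subset_left
  have h2 := ContinuousOn.totalSpaceMk_mfderiv (I := I) (J := I) (g := G) (chartAt H z).open_source
    contMDiffOn_chart h1 (fun q hq => hq.2)
  exact (continuous_snd_tangentBundle_modelSpace (I := I)).comp_continuousOn h2

/-- **The comparison matrix of two frame fields along the same map varies continuously** on the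
region (read in the charts of `M`; `compMat` is invariant under linear automorphisms).
[cite: Steenrod1951, §7–8] -/
theorem IsFrameFieldAlong.continuousOn_compMat {G : Y → M} {F₁ F₂ : Y → Fr m} {R : Set Y}
    (h₁ : IsFrameFieldAlong I G F₁ R) (h₂ : IsFrameFieldAlong I G F₂ R) :
    ContinuousOn (fun q => compMat (F₁ q) (F₂ q)) R := by
  intro q₀ hq₀
  set z := G q₀
  set U := R ∩ G ⁻¹' (chartAt H z).source
  have hU : G ⁻¹' (chartAt H z).source ∈ 𝓝[R] q₀ :=
    (h₁.continuousOn_map q₀ hq₀).preimage_mem_nhdsWithin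
      ((chartAt H z).open_source.mem_nhds (mem_chart_source _ _))
  rw [← continuousWithinAt_inter' hU]
  have hc : ContinuousOn (fun q => compMat (chartReadI I z (G q) (F₁ q)) (chartReadI I z (G q) (F₂ q))) U :=
    StableFrames.continuousOn_compMat (h₁.continuousOn_chartRead z) (h₂.continuousOn_chartRead z)
      fun q hq => linearIndependent_chartReadI (I := I) z hq.2 (h₂.2.2 q hq.1)
  have heq : ∀ q ∈ U, compMat (chartReadI I z (G q) (F₁ q)) (chartReadI I z (G q) (F₂ q)) =
      compMat (F₁ q) (F₂ q) := fun q hq => compMat_chartReadI (I := I) z hq.2 (h₂.2.2 q hq.1)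
  exact ((hc.congr fun q hq => (heq q hq).symm) q₀ ⟨hq₀, mem_chart_source _ _⟩)

/-- A stable frame datum of a manifold with the half-space model is a frame field along any map
continuous on the region (`SFrame` of `SurgeredStableFrameGlue.lean`, `d + 2 = (d + 1) + 1`
fields). [folklore] -/
theorem SFrame.isFrameFieldAlong {d : ℕ} {W : Type*} [TopologicalSpace W]
    [ChartedSpace (EuclideanHalfSpace (d + 1)) W] [IsManifold (𝓡∂ (d + 1)) 1 W] (S : SFrame d W)
    {G : Y → W} {R : Set Y} (hG : ContinuousOn G R) :
    IsFrameFieldAlong (𝓡∂ (d + 1)) G (fun q => fun i => S.s i (G q)) R :=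
  ⟨fun i => (S.cont i).comp_continuousOn hG, fun i => (S.cont₂ i).comp_continuousOn hG,
    fun q _ => S.linearIndependent (G q)⟩

end FrameField

/-! ### The tube cylinder frame of a framed sphere -/

namespace FramedSphereFamily

universe u

attribute [local instance] fact_finrank_euclideanSpace_succ

variable {n k l : ℕ} {X : Type u} [TopologicalSpace X] [ChartedSpace (EuclideanHalfSpace (n + 1)) X]
  [IsManifold (𝓡∂ (n + 1)) ∞ X] {ι : Type u}
  (ν : FramedSphereFamily (𝓡∂ (n + 1)) X ι k (l + 1)) (i : ι) (h : k + 1 + (l + 1) = n + 1 + 1)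

/-- **The tube cylinder frame** of the `i`-th framed sphere at `q = (u, w)`: the
`SurgerySwapMatrix` frame `cylT (u, w) h L` for `L = dφ̂ᵢ_{(u,w)}` — tangential parts
`dφ̂ (eⱼ - ⟪u, (eⱼ)₁⟫ (u, 0))`, normal coefficients `⟪u, (eⱼ)₁⟫`, `eⱼ` the basis `jbasis h`.
[cite: Kosinski1993, Ch. X §2, Lemma (2.1)] -/
def tubeCyl (q : Metric.sphere (0 : EuclideanSpace ℝ (Fin (k + 1))) 1 × EuclideanSpace ℝ (Fin (l + 1))) :
    Fr (n + 1) :=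
  cylT (hyp q) h (ν.coneDeriv i q.1 q.2).toLinearMap

omit [IsManifold (𝓡∂ (n + 1)) ∞ X] in
/-- Values of the tube cylinder frame. [folklore] -/
theorem tubeCyl_apply (q : Metric.sphere (0 : EuclideanSpace ℝ (Fin (k + 1))) 1 × EuclideanSpace ℝ (Fin (l + 1)))
    (j : Fin (n + 1 + 1)) :
    ν.tubeCyl i h q j = (ν.coneDeriv i q.1 q.2 (PT (hyp q) (jbasis h j)), aF (hyp q) (jbasis h j)) := rfl

omit [IsManifold (𝓡∂ (n + 1)) ∞ X] in
/-- **The tube cylinder frame is a frame** (`dφ̂` is injective on `⟪u, ·⟫ = 0`). [folklore] -/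
theorem linearIndependent_tubeCyl
    (q : Metric.sphere (0 : EuclideanSpace ℝ (Fin (k + 1))) 1 × EuclideanSpace ℝ (Fin (l + 1))) :
    LinearIndependent ℝ (ν.tubeCyl i h q) :=
  linearIndependent_cylT h fun x hx h0 => ν.eq_zero_of_coneDeriv_eq_zero i q.1 q.2 x hx h0

/-- **The tube cylinder frame is a stable frame field along the framed sphere** `φᵢ`: its tangent
parts are the push-forwards along the cone `φ̂ᵢ` of the continuous fields
`q ↦ eⱼ - ⟪u, (eⱼ)₁⟫ (u, 0)` of `T(ℝᵏ⁺¹ × ℝˡ⁺¹)`. [cite: Steenrod1951, §7–8] -/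
theorem isFrameFieldAlong_tubeCyl :
    IsFrameFieldAlong (𝓡∂ (n + 1)) (fun q => ν.toFun i q) (ν.tubeCyl i h) univ := by
  refine ⟨fun j => ?_, fun j => ?_, fun q _ => ν.linearIndependent_tubeCyl i h q⟩
  · -- push the field `q ↦ PT (hyp q) (jbasis h j)` along the cone
    have hhypc : Continuous (hyp (k := k) (m := l + 1)) :=
      (continuous_subtype_val.comp continuous_fst).prodMk continuous_snd
    have hV : Continuous fun q : Metric.sphere (0 : EuclideanSpace ℝ (Fin (k + 1))) 1 ×
        EuclideanSpace ℝ (Fin (l + 1)) => PT (hyp q) (jbasis h j) := by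
      have : (fun q : Metric.sphere (0 : EuclideanSpace ℝ (Fin (k + 1))) 1 × EuclideanSpace ℝ (Fin (l + 1)) =>
          PT (hyp q) (jbasis h j)) = fun q => ((jbasis h j).1 - ⟪(q.1 : EuclideanSpace ℝ (Fin (k + 1))),
            (jbasis h j).1⟫ • (q.1 : EuclideanSpace ℝ (Fin (k + 1))), (jbasis h j).2) := by
        funext q; rw [PT_apply]; rfl
      rw [this]
      refine Continuous.prodMk ?_ continuous_const
      have hu : Continuous fun q : Metric.sphere (0 : EuclideanSpace ℝ (Fin (k + 1))) 1 ×
          EuclideanSpace ℝ (Fin (l + 1)) => (q.1 : EuclideanSpace ℝ (Fin (k + 1))) :=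
        continuous_subtype_val.comp continuous_fst
      have hi : Continuous fun q : Metric.sphere (0 : EuclideanSpace ℝ (Fin (k + 1))) 1 ×
          EuclideanSpace ℝ (Fin (l + 1)) => ⟪(q.1 : EuclideanSpace ℝ (Fin (k + 1))), (jbasis h j).1⟫ :=
        hu.inner continuous_const
      exact continuous_const.sub (hi.smul hu)
    have hsrc := continuousOn_totalSpaceMk_prodSelf (E := EuclideanSpace ℝ (Fin (k + 1)))
      (F := EuclideanSpace ℝ (Fin (l + 1))) (t := univ) hhypc.continuousOn hV.continuousOn
    have hpush := ContinuousOn.totalSpaceMk_mfderiv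
      (I := (𝓘(ℝ, EuclideanSpace ℝ (Fin (k + 1)))).prod 𝓘(ℝ, EuclideanSpace ℝ (Fin (l + 1))))
      (J := 𝓡∂ (n + 1)) (f := ν.cone i) (isOpen_ne.preimage continuous_fst)
      ((ν.contMDiffOn_cone i).of_le (by exact_mod_cast le_top)) hsrc
      (fun q _ => ne_zero_of_mem_unit_sphere q.1)
    refine hpush.congr fun q _ => ?_
    change (TotalSpace.mk' _ (ν.toFun i q) _ : TangentBundle (𝓡∂ (n + 1)) X) = TotalSpace.mk' _ (ν.cone i (hyp q)) _
    congr 1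
    · exact (ν.cone_apply_coe i q.1 q.2).symm
  · have hc : Continuous fun q : Metric.sphere (0 : EuclideanSpace ℝ (Fin (k + 1))) 1 ×
        EuclideanSpace ℝ (Fin (l + 1)) => ⟪(q.1 : EuclideanSpace ℝ (Fin (k + 1))), (jbasis h j).1⟫ :=
      (continuous_subtype_val.comp continuous_fst).inner continuous_const
    exact hc.continuousOn.congr fun q _ => by rw [tubeCyl_apply, aF_apply]; rfl

end FramedSphereFamily

end Literature.Topology.FourManifolds

end
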